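import Summits.NavierStokesRegularity.NavierStokesRegularity.Theorems.SoloRefuteThambynayagam2015PlateauKit
import HarnessLib

/-!
# C38 `Thambynayagam2015` — `PlateauReached` is FALSE (ADDENDUM to ADJUDICATED #55; UG CROSS-CHECK v1.31c (5) /
# RULINGS v1.31f (1); countermodel refuter-7 g2, kernel salvage-p5 g2) — Part 2: amplitudes, sequence, non-plateau

See `SoloRefuteThambynayagam2015PlateauKit` (Part 1: drift–shear slice calculus on the tree's `ParallelShear`
lemmas, the datum `cos(2πx₁)e₀ + c e₁` with `isDatum_datum` / `not_inertialPartVanishes_datum`, trigonometric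
profiles). Here: the closed-form amplitudes `Z_l(t) = e^{−4π²κt} Σ_{m<l}(2πict)^m/m!` (`taylorI`, `coef`,
`aCoef`, `bCoef`) with their ODEs `Z_{l+1}' = −4π²κ Z_{l+1} + 2πic Z_l`, `Z_{l+1}(0) = 1`; the levels
`V l t = φ_l(t,x₁)e₀ + c e₁`, inertial terms `U l t = c∂ₛφ_l e₀`, potentials `P ≡ 0`;
`isSequence : IsSequence κ (datum c) (V κ c) (U κ c) P`; `U_succ_ne` (no two consecutive inertial terms
coincide when `c ≠ 0`: a plateau would force `e^{−4π²κ}(2πic)^{k−1}/(k−1)! = 0`); and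
**`not_PlateauReached : ¬ PlateauReached`** (`κ = 1`, `c = 1`).

WHAT THIS IS NOT: not a claim about NS regularity or blow-up; not a claim about any author beyond the typed
locator.
-/

noncomputable section

open Set Function InnerProductSpace
open scoped ContDiff Laplacian InnerProductSpace RealInnerProductSpace Topology

set_option linter.dupNamespace false

namespace Summit.NavierStokesRegularity.NavierStokesRegularity.Theorems.Thambynayagam2015.Plateau

open Literature.Analysis.FluidPDE Literature.Analysis.FluidPDE.ParallelShear Literature.Claims.NS
  Literature.Claims.NS.Thambynayagam2015

/-! ### The complex amplitudes `Z_{n+1}(t) = e^{−λt} Σ_{m ≤ n} (iμt)^m/m!` -/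

/-- Taylor polynomial of `exp` at `iθ`, `n` terms. -/
def taylorI (n : ℕ) (θ : ℝ) : ℂ :=
  ∑ m ∈ Finset.range n, (Complex.I * θ) ^ m / (m.factorial : ℂ)

/-- `taylorI_zero_arg` (C38 plateau kit; see the module docstring). -/
theorem taylorI_zero_arg (n : ℕ) : taylorI (n + 1) 0 = 1 := by
  unfold taylorI
  rw [Finset.sum_range_succ']
  simp

/-- `taylorI_succ_sub` (C38 plateau kit; see the module docstring). -/
theorem taylorI_succ_sub (n : ℕ) (θ : ℝ) :
    taylorI (n + 1) θ - taylorI n θ = (Complex.I * θ) ^ n / (n.factorial : ℂ) := by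
  unfold taylorI
  rw [Finset.sum_range_succ]; ring

/-- `d/dt T_{n+1}(μt) = iμ T_n(μt)`. -/
theorem hasDerivAt_taylorI (n : ℕ) (μ t : ℝ) :
    HasDerivAt (fun τ : ℝ => taylorI (n + 1) (μ * τ)) (Complex.I * μ * taylorI n (μ * t)) t := by
  unfold taylorI
  -- each term `(iμτ)^m/m! = ((iμ)^m/m!) · τ^m`
  have hterm : ∀ m : ℕ, HasDerivAt (fun τ : ℝ => (Complex.I * ((μ * τ : ℝ) : ℂ)) ^ m / (m.factorial : ℂ))
      ((Complex.I * μ) ^ m / (m.factorial : ℂ) * ((m : ℂ) * ((t : ℂ)) ^ (m - 1))) t := by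
    intro m
    have h1 : HasDerivAt (fun y : ℂ => y ^ m) ((m : ℂ) * (t : ℂ) ^ (m - 1)) (t : ℂ) := hasDerivAt_pow m _
    have h2 : HasDerivAt (fun τ : ℝ => ((τ : ℝ) : ℂ) ^ m) ((m : ℂ) * (t : ℂ) ^ (m - 1)) t := h1.comp_ofReal
    have h3 := h2.const_mul ((Complex.I * μ) ^ m / (m.factorial : ℂ))
    refine h3.congr_of_eventuallyEq (Filter.Eventually.of_forall fun τ => ?_)
    simp only [Complex.ofReal_mul]
    ring
  have hsum := HasDerivAt.fun_sum (u := Finset.range (n + 1)) (x := t) fun m _ => hterm m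
  refine hsum.congr_deriv ?_
  rw [Finset.sum_range_succ', Finset.mul_sum]
  simp only [pow_zero, Nat.factorial_zero, Nat.cast_one, div_one, Nat.cast_zero, zero_mul,
    mul_zero, add_zero]
  refine Finset.sum_congr rfl fun m _ => ?_
  have hf : ((m + 1).factorial : ℂ) = (m + 1 : ℂ) * (m.factorial : ℂ) := by
    rw [Nat.factorial_succ]; push_cast; ring
  have hm0 : (m.factorial : ℂ) ≠ 0 := Nat.cast_ne_zero.mpr (Nat.factorial_ne_zero m)
  have hm1 : (m + 1 : ℂ) ≠ 0 := Nat.cast_add_one_ne_zero m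
  rw [hf]
  simp only [Nat.add_sub_cancel, Complex.ofReal_mul, Nat.cast_add, Nat.cast_one]
  field_simp
  ring

/-- The amplitude of level `n+1`: `Z_{n+1}(t) = e^{−λt} T_{n+1}(μt)`, `λ = 4π²κ`, `μ = 2πc`. -/
def coef (κ c : ℝ) (n : ℕ) (t : ℝ) : ℂ :=
  ((Real.exp (-(4 * Real.pi ^ 2 * κ) * t) : ℝ) : ℂ) * taylorI (n + 1) (2 * Real.pi * c * t)

/-- `coef_zero_time` (C38 plateau kit; see the module docstring). -/
theorem coef_zero_time (κ c : ℝ) (n : ℕ) : coef κ c n 0 = 1 := by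
  simp [coef, taylorI_zero_arg]

/-- `hasDerivAt_expFactor` (C38 plateau kit; see the module docstring). -/
theorem hasDerivAt_expFactor (κ t : ℝ) :
    HasDerivAt (fun τ : ℝ => ((Real.exp (-(4 * Real.pi ^ 2 * κ) * τ) : ℝ) : ℂ))
      ((( -(4 * Real.pi ^ 2 * κ) * Real.exp (-(4 * Real.pi ^ 2 * κ) * t)) : ℝ) : ℂ) t := by
  have h := ((hasDerivAt_id t).const_mul (-(4 * Real.pi ^ 2 * κ))).exp
  have h' : HasDerivAt (fun τ : ℝ => Real.exp (-(4 * Real.pi ^ 2 * κ) * τ))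
      (-(4 * Real.pi ^ 2 * κ) * Real.exp (-(4 * Real.pi ^ 2 * κ) * t)) t := by
    simpa [mul_comm] using h
  exact h'.ofReal_comp

/-- Level 1: `Z₁' = −λ Z₁`. -/
theorem hasDerivAt_coef_zero (κ c t : ℝ) :
    HasDerivAt (coef κ c 0) (((-(4 * Real.pi ^ 2 * κ) : ℝ) : ℂ) * coef κ c 0 t) t := by
  have hT : (fun τ : ℝ => taylorI 1 (2 * Real.pi * c * τ)) = fun _ => (1 : ℂ) := by
    funext τ; simp [taylorI]
  have h := (hasDerivAt_expFactor κ t).mul_const (1 : ℂ)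
  have hfun : coef κ c 0 = fun τ => ((Real.exp (-(4 * Real.pi ^ 2 * κ) * τ) : ℝ) : ℂ) * 1 := by
    funext τ; rw [coef, show taylorI (0 + 1) (2 * Real.pi * c * τ) = 1 by simpa using congrFun hT τ]
  rw [hfun]
  refine h.congr_deriv ?_
  push_cast; ring

/-- Levels `n+2`: `Z_{n+2}' = −λ Z_{n+2} + iμ Z_{n+1}`. -/
theorem hasDerivAt_coef_succ (κ c : ℝ) (n : ℕ) (t : ℝ) :
    HasDerivAt (coef κ c (n + 1))
      (((-(4 * Real.pi ^ 2 * κ) : ℝ) : ℂ) * coef κ c (n + 1) t +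
        Complex.I * ((2 * Real.pi * c : ℝ) : ℂ) * coef κ c n t) t := by
  have hE := hasDerivAt_expFactor κ t
  have hT := hasDerivAt_taylorI (n + 1) (2 * Real.pi * c) t
  have h := hE.mul hT
  refine h.congr_deriv ?_
  simp only [coef]
  push_cast
  ring

/-- `contDiff_coef` (C38 plateau kit; see the module docstring). -/
theorem contDiff_coef (κ c : ℝ) (n : ℕ) : ContDiff ℝ ∞ (coef κ c n) := by
  have hE : ContDiff ℝ ∞ (fun t : ℝ => ((Real.exp (-(4 * Real.pi ^ 2 * κ) * t) : ℝ) : ℂ)) :=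
    Complex.ofRealCLM.contDiff.comp (Real.contDiff_exp.comp (contDiff_const.mul contDiff_id))
  have hlin : ContDiff ℝ ∞ (fun t : ℝ => (((2 * Real.pi * c * t : ℝ)) : ℂ)) :=
    Complex.ofRealCLM.contDiff.comp (contDiff_const.mul contDiff_id)
  have hT : ContDiff ℝ ∞ (fun t : ℝ => taylorI (n + 1) (2 * Real.pi * c * t)) := by
    unfold taylorI
    refine ContDiff.sum fun m _ => ?_
    exact ((contDiff_const.mul hlin).pow m).div_const _
  exact hE.mul hT

/-- Real amplitudes: level `0` is the datum (`a = 1`, `b = 0`), level `n+1` is `(Re Z_{n+1}, Im Z_{n+1})`. -/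
def aCoef (κ c : ℝ) : ℕ → ℝ → ℝ
  | 0 => fun _ => 1
  | n + 1 => fun t => (coef κ c n t).re

/-- See `aCoef`. -/
def bCoef (κ c : ℝ) : ℕ → ℝ → ℝ
  | 0 => fun _ => 0
  | n + 1 => fun t => (coef κ c n t).im

/-- `contDiff_aCoef` (C38 plateau kit; see the module docstring). -/
theorem contDiff_aCoef (κ c : ℝ) : ∀ l : ℕ, ContDiff ℝ ∞ (aCoef κ c l)
  | 0 => contDiff_const
  | n + 1 => Complex.reCLM.contDiff.comp (contDiff_coef κ c n)

/-- `contDiff_bCoef` (C38 plateau kit; see the module docstring). -/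
theorem contDiff_bCoef (κ c : ℝ) : ∀ l : ℕ, ContDiff ℝ ∞ (bCoef κ c l)
  | 0 => contDiff_const
  | n + 1 => Complex.imCLM.contDiff.comp (contDiff_coef κ c n)

/-- `hasDerivAt_re` (C38 plateau kit; see the module docstring). -/
theorem hasDerivAt_re {f : ℝ → ℂ} {f' : ℂ} {t : ℝ} (h : HasDerivAt f f' t) :
    HasDerivAt (fun τ => (f τ).re) f'.re t := by
  have h2 := Complex.reCLM.hasFDerivAt.comp_hasDerivAt t h
  simpa [Function.comp_def] using h2

/-- `hasDerivAt_im` (C38 plateau kit; see the module docstring). -/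
theorem hasDerivAt_im {f : ℝ → ℂ} {f' : ℂ} {t : ℝ} (h : HasDerivAt f f' t) :
    HasDerivAt (fun τ => (f τ).im) f'.im t := by
  have h2 := Complex.imCLM.hasFDerivAt.comp_hasDerivAt t h
  simpa [Function.comp_def] using h2

/-- `pi_sq_re` (C38 plateau kit; see the module docstring). -/
theorem pi_sq_re : ((Real.pi : ℂ) ^ 2).re = Real.pi ^ 2 := by
  rw [← Complex.ofReal_pow]; exact Complex.ofReal_re _

/-- `pi_sq_im` (C38 plateau kit; see the module docstring). -/
theorem pi_sq_im : ((Real.pi : ℂ) ^ 2).im = 0 := by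
  rw [← Complex.ofReal_pow]; exact Complex.ofReal_im _

/-- The real ODE system: `a_{l+1}' = −λ a_{l+1} − μ b_l`, `b_{l+1}' = −λ b_{l+1} + μ a_l` (`l ≥ 0`; for `l = 0`
the source terms are those of level 1, i.e. `−μ·0`/`+μ·1`?? — NO: level 1 has source 0). We state the two
cases separately. Level 1: -/
theorem hasDerivAt_ab_one (κ c t : ℝ) :
    HasDerivAt (aCoef κ c 1) (-(4 * Real.pi ^ 2 * κ) * aCoef κ c 1 t) t ∧
    HasDerivAt (bCoef κ c 1) (-(4 * Real.pi ^ 2 * κ) * bCoef κ c 1 t) t := by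
  refine ⟨(hasDerivAt_re (hasDerivAt_coef_zero κ c t)).congr_deriv ?_,
    (hasDerivAt_im (hasDerivAt_coef_zero κ c t)).congr_deriv ?_⟩
  · simp [aCoef, pi_sq_re, pi_sq_im]
  · simp [bCoef, pi_sq_re, pi_sq_im]

/-- Levels `n+2`. -/
theorem hasDerivAt_ab_succ (κ c : ℝ) (n : ℕ) (t : ℝ) :
    HasDerivAt (aCoef κ c (n + 2))
      (-(4 * Real.pi ^ 2 * κ) * aCoef κ c (n + 2) t - 2 * Real.pi * c * bCoef κ c (n + 1) t) t ∧
    HasDerivAt (bCoef κ c (n + 2))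
      (-(4 * Real.pi ^ 2 * κ) * bCoef κ c (n + 2) t + 2 * Real.pi * c * aCoef κ c (n + 1) t) t := by
  refine ⟨(hasDerivAt_re (hasDerivAt_coef_succ κ c n t)).congr_deriv ?_,
    (hasDerivAt_im (hasDerivAt_coef_succ κ c n t)).congr_deriv ?_⟩
  · simp [aCoef, bCoef, Complex.mul_re, Complex.add_re, Complex.I_re, Complex.I_im,
      Complex.ofReal_re, Complex.ofReal_im, pi_sq_re, pi_sq_im]
    ring
  · simp [aCoef, bCoef, Complex.mul_im, Complex.add_im, Complex.I_re, Complex.I_im,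
      Complex.ofReal_re, Complex.ofReal_im, pi_sq_re, pi_sq_im]

/-- `aCoef_zero_time` (C38 plateau kit; see the module docstring). -/
theorem aCoef_zero_time (κ c : ℝ) : ∀ l : ℕ, aCoef κ c l 0 = 1
  | 0 => rfl
  | n + 1 => by simp [aCoef, coef_zero_time]

/-- `bCoef_zero_time` (C38 plateau kit; see the module docstring). -/
theorem bCoef_zero_time (κ c : ℝ) : ∀ l : ℕ, bCoef κ c l 0 = 0
  | 0 => rfl
  | n + 1 => by simp [bCoef, coef_zero_time]

/-! ### The sequence -/

/-- Profile of level `l` at time `t`. -/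
def prof (κ c : ℝ) (l : ℕ) (t : ℝ) : ℝ → ℝ := trig (aCoef κ c l t) (bCoef κ c l t)

/-- `v⁽ˡ⁾(·,t)`. -/
def V (κ c : ℝ) (l : ℕ) (t : ℝ) : E3 → E3 := driftShear c (prof κ c l t)

/-- `𝓤⁽ˡ⁾(·,t) = c ∂ₛφ_l(t, x₁) e₀`. -/
def U (κ c : ℝ) (l : ℕ) (t : ℝ) (x : E3) : E3 := (c * deriv (prof κ c l t) (x 1)) • e0

/-- The potentials: all zero. -/
def P (_l : ℕ) (_t : ℝ) (_x : E3) : ℝ := 0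

/-- `V_zero` (C38 plateau kit; see the module docstring). -/
theorem V_zero (κ c : ℝ) (t : ℝ) : V κ c 0 t = datum c := by
  simp [V, prof, aCoef, bCoef, trig_one_zero, datum]

/-- Joint smoothness of a level. -/
theorem contDiff_uncurry_V (κ c : ℝ) (l : ℕ) : ContDiff ℝ ∞ (uncurry (V κ c l)) := by
  have ha := contDiff_aCoef κ c l
  have hb := contDiff_bCoef κ c l
  have h1 : ContDiff ℝ ∞ (fun q : ℝ × E3 => q.2 1) :=
    (EuclideanSpace.proj (1 : Fin 3) : E3 →L[ℝ] ℝ).contDiff.comp contDiff_snd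
  have h0 : ContDiff ℝ ∞ (fun q : ℝ × E3 =>
      aCoef κ c l q.1 * Real.cos (2 * Real.pi * q.2 1) + bCoef κ c l q.1 * Real.sin (2 * Real.pi * q.2 1)) :=
    ((ha.comp contDiff_fst).mul ((contDiff_const.mul h1).cos)).add
      ((hb.comp contDiff_fst).mul ((contDiff_const.mul h1).sin))
  have h : ContDiff ℝ ∞ (fun q : ℝ × E3 =>
      (aCoef κ c l q.1 * Real.cos (2 * Real.pi * q.2 1) + bCoef κ c l q.1 * Real.sin (2 * Real.pi * q.2 1))
        • e0 + c • e1) :=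
    (h0.smul (contDiff_const : ContDiff ℝ ∞ fun _ : ℝ × E3 => e0)).add contDiff_const
  have hfun : uncurry (V κ c l) = fun q : ℝ × E3 =>
      (aCoef κ c l q.1 * Real.cos (2 * Real.pi * q.2 1) + bCoef κ c l q.1 * Real.sin (2 * Real.pi * q.2 1))
        • e0 + c • e1 := by
    funext q; simp [uncurry, V, driftShear, prof, trig]
  rw [hfun]; exact h

/-- `isSmoothSpaceTimeOn_V` (C38 plateau kit; see the module docstring). -/
theorem isSmoothSpaceTimeOn_V (κ c : ℝ) (l : ℕ) : IsSmoothSpaceTimeOn (Ici 0) (V κ c l) :=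
  (contDiff_uncurry_V κ c l).contDiffOn

/-- Time derivative of a level at a point. -/
theorem hasDerivAt_V_time (κ c : ℝ) (l : ℕ) (x : E3) {a' b' : ℝ} {t : ℝ}
    (ha : HasDerivAt (aCoef κ c l) a' t) (hb : HasDerivAt (bCoef κ c l) b' t) :
    HasDerivAt (fun τ => V κ c l τ x) (trig a' b' (x 1) • e0) t := by
  have h := ((ha.mul_const (Real.cos (2 * Real.pi * x 1))).add
    (hb.mul_const (Real.sin (2 * Real.pi * x 1)))).smul_const e0 |>.add_const (c • e1)
  refine h.congr_of_eventuallyEq (Filter.Eventually.of_forall fun τ => ?_)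
  simp [V, driftShear, prof, trig]

/-- `timeDerivWithin_V` (C38 plateau kit; see the module docstring). -/
theorem timeDerivWithin_V (κ c : ℝ) (l : ℕ) (x : E3) {a' b' : ℝ} {t : ℝ} (ht : 0 ≤ t)
    (ha : HasDerivAt (aCoef κ c l) a' t) (hb : HasDerivAt (bCoef κ c l) b' t) :
    timeDerivWithin (Ici 0) (V κ c l) t x = trig a' b' (x 1) • e0 := by
  rw [timeDerivWithin_apply]
  exact (hasDerivAt_V_time κ c l x ha hb).hasDerivWithinAt.derivWithin (uniqueDiffOn_Ici 0 t ht)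

/-- `laplacian_V` (C38 plateau kit; see the module docstring). -/
theorem laplacian_V (κ c : ℝ) (l : ℕ) (t : ℝ) (x : E3) :
    Δ (V κ c l t) x = (-(4 * Real.pi ^ 2) * prof κ c l t (x 1)) • e0 := by
  rw [V, prof, laplacian_driftShear c (contDiff_trig _ _ (n := 2)) x, deriv_deriv_trig]

/-- `U_apply` (C38 plateau kit; see the module docstring). -/
theorem U_apply (κ c : ℝ) (l : ℕ) (t : ℝ) (x : E3) :
    U κ c l t x = (c * trig (2 * Real.pi * bCoef κ c l t) (-(2 * Real.pi * aCoef κ c l t)) (x 1)) • e0 := by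
  rw [U, prof, deriv_trig]

/-- The common part of every `IsLinearStep` verification. -/
theorem isLinearStep_V (κ c : ℝ) (l : ℕ) (F : ℝ → E3 → E3)
    (heqn : ∀ t : ℝ, 0 ≤ t → ∀ x, timeDerivWithin (Ici 0) (V κ c (l + 1)) t x =
      κ • (Δ (V κ c (l + 1) t)) x - F t x) :
    IsLinearStep κ (datum c) F (V κ c (l + 1)) where
  smooth := isSmoothSpaceTimeOn_V κ c (l + 1)
  periodic := fun t _ => isLatticePeriodic_driftShear c (trig_periodic _ _)
  divFree := fun t _ => isDivFree_driftShear c ((contDiff_trig _ _ (n := ∞)).differentiable (by simp))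
  initial := by
    funext x
    simp [V, prof, aCoef_zero_time, bCoef_zero_time, trig_one_zero, datum]
  eqn := heqn

/-- Sequence 1 = the heat flow (source `0`). -/
theorem seq1 (κ c : ℝ) : IsLinearStep κ (datum c) 0 (V κ c 1) := by
  refine isLinearStep_V κ c 0 0 fun t ht x => ?_
  obtain ⟨ha, hb⟩ := hasDerivAt_ab_one κ c t
  rw [timeDerivWithin_V κ c 1 x ht ha hb, laplacian_V]
  simp only [Pi.zero_apply, sub_zero, smul_smul, prof, trig]
  congr 1
  ring

/-- Sequence `n+2` = the linear step with source `𝓤⁽ⁿ⁺¹⁾`. -/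
theorem step (κ c : ℝ) (n : ℕ) : IsLinearStep κ (datum c) (U κ c (n + 1)) (V κ c (n + 2)) := by
  refine isLinearStep_V κ c (n + 1) (U κ c (n + 1)) fun t ht x => ?_
  obtain ⟨ha, hb⟩ := hasDerivAt_ab_succ κ c n t
  rw [timeDerivWithin_V κ c (n + 2) x ht ha hb, laplacian_V, U_apply]
  simp only [smul_smul, prof, trig, ← sub_smul]
  congr 1
  ring

/-- The inertial parts. -/
theorem inertial (κ c : ℝ) (l : ℕ) (t : ℝ) : IsInertialPart (V κ c l t) (U κ c l t) (P l t) := by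
  have h := isInertialPart_driftShear c (ψ := prof κ c l t) (contDiff_trig _ _) (fun s => by
    rw [prof, deriv_trig]; exact trig_periodic _ _ _)
  exact h

/-- **The instantaneous sequence of §4 for the datum `cos(2πx₁)e₀ + c e₁`, in closed form.** -/
theorem isSequence (κ c : ℝ) : IsSequence κ (datum c) (V κ c) (U κ c) P where
  level0 := V_zero κ c
  inertial := fun l t _ => inertial κ c l t
  smoothP := fun _ => contDiffOn_const
  seq1 := seq1 κ c
  step := fun l hl => by
    obtain ⟨n, rfl⟩ : ∃ n, l = n + 1 := ⟨l - 1, by omega⟩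
    exact step κ c n

/-! ### Non-plateau -/

/-- Two consecutive inertial terms never coincide (for `c ≠ 0`): equality of `𝓤⁽ⁿ⁺²⁾` and `𝓤⁽ⁿ⁺¹⁾` at
all `t ≥ 0` would force `Z_{n+2}(1) = Z_{n+1}(1)`, i.e. `(iμ)^{n+1}/(n+1)! = 0`. -/
theorem U_succ_ne (κ : ℝ) {c : ℝ} (hc : c ≠ 0) (n : ℕ) :
    ¬ ∀ t : ℝ, 0 ≤ t → U κ c (n + 2) t = U κ c (n + 1) t := by
  intro h
  have h1 := h 1 zero_le_one
  -- evaluate at `x = 0` (reads off `b`) and at `x = ¼ e₁` (reads off `a`)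
  have hb : bCoef κ c (n + 2) 1 = bCoef κ c (n + 1) 1 := by
    have := congrArg (fun v : E3 => v 0) (congrFun h1 (0 : E3))
    simp only [U_apply, PiLp.zero_apply, trig_zero, PiLp.smul_apply, smul_eq_mul] at this
    have h2π : (2 * Real.pi) ≠ 0 := by positivity
    field_simp at this
    simpa using this
  have ha : aCoef κ c (n + 2) 1 = aCoef κ c (n + 1) 1 := by
    have := congrArg (fun v : E3 => v 0) (congrFun h1 (EuclideanSpace.single (1 : Fin 3) (1 / 4 : ℝ)))
    simp only [U_apply, PiLp.smul_apply, smul_eq_mul] at this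
    rw [show (EuclideanSpace.single (1 : Fin 3) (1 / 4 : ℝ) : E3) 1 = 1 / 4 by simp, trig_quarter,
      trig_quarter] at this
    have h2π : (2 * Real.pi) ≠ 0 := by positivity
    field_simp at this
    simpa using this
  -- hence `Z_{n+2}(1) = Z_{n+1}(1)`
  have hZ : coef κ c (n + 1) 1 = coef κ c n 1 := by
    apply Complex.ext
    · simpa [aCoef] using ha
    · simpa [bCoef] using hb
  -- but their difference is `e^{−λ}(iμ)^{n+1}/(n+1)! ≠ 0`
  have hdiff : coef κ c (n + 1) 1 - coef κ c n 1 =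
      ((Real.exp (-(4 * Real.pi ^ 2 * κ) * 1) : ℝ) : ℂ) *
        ((Complex.I * ((2 * Real.pi * c * 1 : ℝ) : ℂ)) ^ (n + 1) / ((n + 1).factorial : ℂ)) := by
    simp only [coef, ← mul_sub, taylorI_succ_sub]
  have hne : coef κ c (n + 1) 1 - coef κ c n 1 ≠ 0 := by
    rw [hdiff]
    apply mul_ne_zero
    · exact_mod_cast (Real.exp_pos _).ne'
    · apply div_ne_zero
      · apply pow_ne_zero
        apply mul_ne_zero Complex.I_ne_zero
        exact_mod_cast (by positivity : (2 * Real.pi * c * 1) ≠ 0)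
      · exact Nat.cast_ne_zero.mpr (Nat.factorial_ne_zero _)
  exact hne (by rw [hZ, sub_self])

/-- **`PlateauReached` is false**: for `κ = 1` and the datum `cos(2πx₁)e₀ + e₁` (drift `c = 1`), the §4
sequence exists in closed form and NO two consecutive inertial terms `𝓤⁽ᵏ⁾, 𝓤⁽ᵏ⁻¹⁾` (`k ≥ 2`) coincide.
Countermodel: refuter-7 g2 (UG-AUDIT C38, 2026-08-27); kernel: salvage-p5 g2.
[cite: Thambynayagam2015, §4 p.5 l.520–531] -/
theorem not_PlateauReached : ¬ PlateauReached := by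
  intro h
  obtain ⟨k, hk, hplat⟩ := h 1 one_pos (datum 1) (isDatum_datum 1)
    (not_inertialPartVanishes_datum one_ne_zero) (V 1 1) (U 1 1) P (isSequence 1 1)
  obtain ⟨n, rfl⟩ : ∃ n, k = n + 2 := ⟨k - 2, by omega⟩
  exact U_succ_ne 1 one_ne_zero n (by simpa using hplat)

end Summit.NavierStokesRegularity.NavierStokesRegularity.Theorems.Thambynayagam2015.Plateau

end
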